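import Literature.MathematicalPhysics.QuantumFieldTheory.PlaquetteFieldPolymers
import Literature.MathematicalPhysics.QuantumFieldTheory.CentralTwistTensorForm
import HarnessLib

/-!
# Twist locality for EVERY 't Hooft twist: on a polymer with fewer than `L²` plaquettes the insertion of a general twist
# (all planes at once) is removed by a change of variables

Topic `Literature/MathematicalPhysics/QuantumFieldTheory`; vocabulary of `PlaquetteFieldPolymers.lean` (namespace `CentralTwist`:
`twistBy t w`, `twistInsertion z`, `fieldActivity`, `fieldPolymerActivity` for a plaquette-dependent family `w : Plaquette d L → G → ℝ`),
`CentralTwistFluxRemoval.lean` (`cochainMul ζ η`, `fluxInt`, `pathCochain`, `plaquetteHolonomy_cochainMul`, `integral_comp_cochainMul`,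
`exists_sheetAt_disjoint`), `CentralTwistTensorForm.lean` (`plaquetteTwist_mulSingle`) and `QuantumLattice/TwistedBoundaryConditions.lean`
(`Twist d G = Plane d → Z(G)`, `plaquetteTwist`).  THEOREMS ONLY (no definition, no fact).

E. T. Tomboulis, arXiv:0707.2179 [Tomboulis2007Confinement] §6.2, text after (6.9): the flux "does not affect polymers that are wholly
contained in a simply connected part of `Λ`, since, in this case, the flux can be removed by a change of variables in the integrals …
Only clusters that contain at least one non-simply connected polymer forming a topologically non-trivially closed surface can be
affected", and (6.11): such a polymer has at least `A = L₁L₂` plaquettes.  The file `CentralTwistFluxRemoval.lean` proves this for ONE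
central element on ONE plane; G. 't Hooft, Nucl. Phys. B153 (1979) 141 [tHooft1979Flux] §2 (2.2)–(2.6) twists every plane `(μ,ν)` by its
own centre element `z_{μν}`.  Here the statement is proved for EVERY twist `z : Twist d G` and every plaquette-dependent background:

* `fieldPolymerActivity_twistBy_eq_of_cochain` — the change of variables `U_b ↦ ζ^{η(b)} U_b` (central `ζ`, integer link cochain
  `η`) trades an insertion `t` for `t · ζ^{δη}` inside a polymer activity (Haar invariance);
* `fieldPolymerActivity_twistBy_sheet_eq` — ONE central element on ONE parallel sheet `𝒱^{(ij)}_{a₀,b₀}` of a polymer with `#X < L²`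
  is removed: some parallel sheet misses `X` (`exists_sheetAt_disjoint`, T07 (6.11)) and the difference of the two path cochains
  (`fluxInt_pathCochain`) moves the twist there — for an ARBITRARY family `w`, so any background insertion is allowed;
* `plaquetteTwist_mul`, `twistInsertion_mul`, `twistInsertion_mulSingle` — a general twist is the product over planes of single-plane
  twists, whose insertions live on the corner sheets `𝒱^{(q)}_{-1,-1}`;
* ★ `fieldPolymerActivity_twistInsertion_eq_of_card_lt` — for EVERY twist `z : Twist d G` (all planes at once), every family `w`
  and every `X` with `#X < L²`: `z_{w ∘ t_z}(X) = z_w(X)` (induction on the set of twisted planes);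
  `fieldPolymerActivity_twistInsertion_background_eq_of_card_lt` — the same on top of any background insertion `t`.

HONEST FRAMING: symmetric tori `(ℤ/Lℤ)^d`; a combinatorial/measure-theoretic identity, nothing about convergence or any limit.
-/

noncomputable section

open MeasureTheory Finset
open scoped BigOperators
open Literature.MathematicalPhysics.QuantumLattice
open Literature.Probability.LatticeModels (IsRConnected GeomInc Touches)

namespace Literature.MathematicalPhysics.QuantumFieldTheory

namespace CentralTwist

open Tomboulis2007

variable {d L : ℕ} {G : Type*} [Group G]

/-! ## The algebra of twist insertions: products over planes -/

section InsertionAlgebra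

/-- The plaquette twist is multiplicative in the twist (pointwise product of centre elements, plane by plane).
[cite: tHooft1979Flux, §2 eq. (2.5)] -/
theorem plaquetteTwist_mul (z z' : QuantumLattice.Twist d G) (p : Plaquette d L) :
    QuantumLattice.plaquetteTwist (z * z') p = QuantumLattice.plaquetteTwist z p * QuantumLattice.plaquetteTwist z' p := by
  unfold QuantumLattice.plaquetteTwist
  split_ifs
  · rw [Pi.mul_apply, Subgroup.coe_mul]
  · rw [mul_one]

/-- The twist insertion is multiplicative in the twist (the values are central, so the order is immaterial).
[cite: tHooft1979Flux, §2 eqs. (2.5)–(2.6)] -/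
theorem twistInsertion_mul (z z' : QuantumLattice.Twist d G) (p : Plaquette d L) :
    twistInsertion (z * z') p = twistInsertion z p * twistInsertion z' p := by
  rw [twistInsertion_apply, twistInsertion_apply, twistInsertion_apply, plaquetteTwist_mul, mul_inv_rev]
  exact (Subgroup.mem_center_iff.1 (Subgroup.inv_mem _ (QuantumLattice.plaquetteTwist_mem_center z' p)) _).symm

/-- **The insertion of a single-plane twist lives on the corner sheet**: for `z = mulSingle (i,j) ζ` the insertion is `ζ⁻¹` on
`𝒱^{(ij)}_{-1,-1}` (the corner plaquettes `x_i = x_j = L-1` of the `(i,j)`-planes) and `1` elsewhere.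
[cite: GarciaperezGonzalezarroyoOkawa2014, §6] [cite: tHooft1979Flux, §2 eqs. (2.5)–(2.6)] -/
theorem twistInsertion_mulSingle [NeZero L] (ζ : Subgroup.center G) {i j : Fin d} (hij : i < j) (p : Plaquette d L) :
    twistInsertion (Pi.mulSingle (⟨(i, j), hij⟩ : QuantumLattice.Plane d) ζ) p =
      if p ∈ sheetAt L (-1) (-1) i j hij then ((ζ : G)⁻¹) else 1 := by
  rw [twistInsertion_apply, plaquetteTwist_mulSingle ζ hij p]
  split_ifs
  · rfl
  · exact inv_one

/-- A twist trivial on every plane is the trivial twist, whose insertion is `1`. [cite: tHooft1979Flux, §2 eqs. (2.5)–(2.6)] -/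
theorem twistInsertion_eq_one_of_forall (z : QuantumLattice.Twist d G) (hz : ∀ q, z q = 1) :
    twistInsertion (L := L) z = fun _ => (1 : G) := by
  have h1 : z = 1 := funext fun q => hz q
  rw [h1, twistInsertion_one]

/-- Splitting off one plane: `z = z' · mulSingle q₀ (z q₀)` with `z' = z` off `q₀` and `z' q₀ = 1`.
[cite: tHooft1979Flux, §2 eq. (2.5)] -/
theorem twist_eq_update_mul_mulSingle (z : QuantumLattice.Twist d G) (q₀ : QuantumLattice.Plane d) :
    z = Function.update z q₀ 1 * Pi.mulSingle q₀ (z q₀) := by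
  funext q
  rw [Pi.mul_apply]
  by_cases hq : q = q₀
  · subst hq
    rw [Function.update_self, Pi.mulSingle_eq_same, one_mul]
  · rw [Function.update_of_ne hq, Pi.mulSingle_eq_of_ne hq, mul_one]

end InsertionAlgebra

/-! ## Removing a twist from a small polymer by a change of variables -/

section Locality

variable [TopologicalSpace G] [IsTopologicalGroup G] [CompactSpace G] [MeasurableSpace G] [BorelSpace G] [NeZero L]

open Literature.Probability.LatticeModels

/-- **Trading an insertion for a cohomologous one inside a polymer activity**: if `t_p · ζ^{δη(p)} = t'_p` for all `p ∈ X`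
(`ζ` central, `η` an integer link cochain), then `z_{w∘t}(X) = z_{w∘t'}(X)` — substitute `U_b ↦ ζ^{η(b)} U_b` (Haar invariance,
`integral_comp_cochainMul`; the holonomies pick up `ζ^{δη(p)}`, `plaquetteHolonomy_cochainMul`).  No hypothesis on the family `w`.
[cite: Tomboulis2007Confinement, §6.2 (text after eq. (6.9))] [cite: Greensite2011Confinement, §4.3 (4.36)–(4.37)] -/
theorem fieldPolymerActivity_twistBy_eq_of_cochain {ζ : G} (hζ : ∀ g : G, ζ * g = g * ζ) (η : Edge d L → ℤ)
    (w : Plaquette d L → G → ℝ) {t t' : Plaquette d L → G} {X : Finset (Plaquette d L)}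
    (h : ∀ p ∈ X, t p * ζ ^ fluxInt η p.1 p.2.1.1 p.2.1.2 = t' p) :
    fieldPolymerActivity (twistBy t w) X = fieldPolymerActivity (twistBy t' w) X := by
  by_cases hconn : IsRConnected linkRel X
  · rw [fieldPolymerActivity_of_isRConnected hconn, fieldPolymerActivity_of_isRConnected hconn]
    congr 1
    have key : ∀ U : GaugeConfig d L G,
        ∏ p ∈ X, fieldActivity (twistBy t w) (cochainMul ζ η U) p = ∏ p ∈ X, fieldActivity (twistBy t' w) U p := by
      intro U
      refine Finset.prod_congr rfl fun p hp => ?_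
      rw [fieldActivity_twistBy, fieldActivity_twistBy, plaquetteHolonomy_cochainMul hζ, ← mul_assoc, h p hp]
    calc ∫ U, ∏ p ∈ X, fieldActivity (twistBy t w) U p ∂(Measure.pi fun _ : Edge d L => haarProbability G)
        = ∫ U, ∏ p ∈ X, fieldActivity (twistBy t w) (cochainMul ζ η U) p
            ∂(Measure.pi fun _ : Edge d L => haarProbability G) :=
          (integral_comp_cochainMul ζ η _).symm
      _ = ∫ U, ∏ p ∈ X, fieldActivity (twistBy t' w) U p ∂(Measure.pi fun _ : Edge d L => haarProbability G) := by
          congr 1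
          funext U
          exact key U
  · rw [fieldPolymerActivity_of_not_isRConnected hconn, fieldPolymerActivity_of_not_isRConnected hconn]

/-- **Twist locality for one central element on one parallel sheet, any background** (arXiv:0707.2179 §6.2 after (6.9) and
(6.11)): if `X` has fewer than `L²` plaquettes, some parallel sheet `𝒱_{a,b}` of the `(i,j)`-planes misses `X`, the change of
variables along `pathCochain(a,b) - pathCochain(a₀,b₀)` moves the central element `ζ` from `𝒱_{a₀,b₀}` to `𝒱_{a,b}`, and so
the activity of `X` for the family `w` with `ζ` inserted on `𝒱_{a₀,b₀}` equals the activity for `w` itself.  The family `w` is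
arbitrary (in particular it may already carry any other insertion). [cite: Tomboulis2007Confinement, §6.2 (text after eq. (6.9)) and eq. (6.11)] -/
theorem fieldPolymerActivity_twistBy_sheet_eq {ζ : G} (hζ : ∀ g : G, ζ * g = g * ζ) (w : Plaquette d L → G → ℝ)
    {i j : Fin d} (hij : i < j) (a₀ b₀ : ZMod L) {X : Finset (Plaquette d L)} (hX : X.card < L ^ 2) :
    fieldPolymerActivity (twistBy (fun p => if p ∈ sheetAt L a₀ b₀ i j hij then ζ else 1) w) X =
      fieldPolymerActivity w X := by
  obtain ⟨a, b, hab⟩ := exists_sheetAt_disjoint hij hX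
  have h := fieldPolymerActivity_twistBy_eq_of_cochain hζ (pathCochain L a b i j - pathCochain L a₀ b₀ i j) w
    (t := fun p => if p ∈ sheetAt L a₀ b₀ i j hij then ζ else 1) (t' := fun _ => (1 : G)) (X := X) ?_
  · rw [h, twistBy_one]
  · intro p hp
    have hpV : p ∉ sheetAt L a b i j hij := fun h' => Finset.disjoint_left.1 hab h' hp
    rw [fluxInt_sub, fluxInt_pathCochain L a b hij, fluxInt_pathCochain L a₀ b₀ hij, if_neg hpV]
    by_cases hp0 : p ∈ sheetAt L a₀ b₀ i j hij
    · rw [if_pos hp0, if_pos hp0]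
      have he : (0 : ℤ) - (if p ∈ sheetAt L 0 0 i j hij then (1 : ℤ) else 0) -
          (1 - (if p ∈ sheetAt L 0 0 i j hij then (1 : ℤ) else 0)) = -1 := by ring
      rw [he, zpow_neg, zpow_one, mul_inv_cancel]
    · rw [if_neg hp0, if_neg hp0, sub_self, zpow_zero, mul_one]

/-- The same with a background insertion `t` kept (the removed sheet element multiplies `t`).
[cite: Tomboulis2007Confinement, §6.2 (text after eq. (6.9)) and eq. (6.11)] -/
theorem fieldPolymerActivity_twistBy_mul_sheet_eq {ζ : G} (hζ : ∀ g : G, ζ * g = g * ζ) (t : Plaquette d L → G)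
    (w : Plaquette d L → G → ℝ) {i j : Fin d} (hij : i < j) (a₀ b₀ : ZMod L) {X : Finset (Plaquette d L)}
    (hX : X.card < L ^ 2) :
    fieldPolymerActivity (twistBy (fun p => t p * (if p ∈ sheetAt L a₀ b₀ i j hij then ζ else 1)) w) X =
      fieldPolymerActivity (twistBy t w) X := by
  rw [← twistBy_twistBy]
  exact fieldPolymerActivity_twistBy_sheet_eq hζ (twistBy t w) hij a₀ b₀ hX

/-- **★ Twist locality for EVERY 't Hooft twist** (all planes at once; every compact group, every plaquette-dependent family
`w`, no hypothesis on the order of the centre elements): if `X` has fewer than `L²` plaquettes then the activity of `X` for the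
family twisted by `z : Twist d G` — insertion `z_p⁻¹` on the corner plaquette of every plane — equals its untwisted activity,
`z_{w∘t_z}(X) = z_w(X)`.  Proof: split `z` into single-plane twists (`twist_eq_update_mul_mulSingle`, induction on the set of
twisted planes) and remove them one at a time (`fieldPolymerActivity_twistBy_sheet_eq` on the corner sheet `𝒱^{(q)}_{-1,-1}`).
(arXiv:0707.2179 §6.2 after (6.9): "Only clusters that contain at least one non-simply connected polymer forming a topologically
non-trivially closed surface can be affected"; 't Hooft 1979 §2: twists on all planes.)
[cite: Tomboulis2007Confinement, §6.2 (text after eq. (6.9)) and eq. (6.11)] [cite: tHooft1979Flux, §2 eqs. (2.5)–(2.6)] -/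
theorem fieldPolymerActivity_twistInsertion_eq_of_card_lt (z : QuantumLattice.Twist d G) (w : Plaquette d L → G → ℝ)
    {X : Finset (Plaquette d L)} (hX : X.card < L ^ 2) :
    fieldPolymerActivity (twistBy (twistInsertion z) w) X = fieldPolymerActivity w X := by
  classical
  suffices hS : ∀ (S : Finset (QuantumLattice.Plane d)) (z : QuantumLattice.Twist d G), (∀ q, q ∉ S → z q = 1) →
      ∀ w : Plaquette d L → G → ℝ, fieldPolymerActivity (twistBy (twistInsertion z) w) X = fieldPolymerActivity w X from
    hS Finset.univ z (fun q hq => (hq (Finset.mem_univ q)).elim) w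
  intro S
  induction S using Finset.induction_on with
  | empty =>
    intro z hz w
    rw [twistInsertion_eq_one_of_forall z (fun q => hz q (Finset.notMem_empty q)), twistBy_one]
  | insert q₀ S hq₀ ih =>
    intro z hz w
    have hz' : ∀ q, q ∉ S → Function.update z q₀ 1 q = 1 := by
      intro q hq
      by_cases hqq : q = q₀
      · subst hqq
        exact Function.update_self _ _ _
      · rw [Function.update_of_ne hqq]
        exact hz q (fun h => (Finset.mem_insert.1 h).elim hqq hq)
    have hsplit : twistInsertion (L := L) z =
        fun p => twistInsertion (Function.update z q₀ 1) p * twistInsertion (Pi.mulSingle q₀ (z q₀)) p := by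
      funext p
      rw [← twistInsertion_mul, ← twist_eq_update_mul_mulSingle z q₀]
    rw [hsplit, ← twistBy_twistBy]
    obtain ⟨⟨i, j⟩, hij⟩ := q₀
    have hζ : ∀ g : G, ((z ⟨(i, j), hij⟩ : G)⁻¹) * g = g * ((z ⟨(i, j), hij⟩ : G)⁻¹) := fun g =>
      (Subgroup.mem_center_iff.1 (Subgroup.inv_mem _ (z ⟨(i, j), hij⟩).2) g).symm
    have hcorner : twistInsertion (L := L) (Pi.mulSingle (⟨(i, j), hij⟩ : QuantumLattice.Plane d) (z ⟨(i, j), hij⟩)) =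
        fun p => if p ∈ sheetAt L (-1) (-1) i j hij then ((z ⟨(i, j), hij⟩ : G)⁻¹) else 1 :=
      funext fun p => twistInsertion_mulSingle (z ⟨(i, j), hij⟩) hij p
    rw [hcorner, fieldPolymerActivity_twistBy_sheet_eq hζ _ hij (-1) (-1) hX]
    exact ih (Function.update z ⟨(i, j), hij⟩ 1) hz' w

/-- **Twist locality for every twist on top of any background insertion `t`**: `z_{w∘(t·t_z)}(X) = z_{w∘t}(X)` for `#X < L²`.
[cite: Tomboulis2007Confinement, §6.2 (text after eq. (6.9)) and eq. (6.11)] [cite: tHooft1979Flux, §2 eqs. (2.5)–(2.6)] -/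
theorem fieldPolymerActivity_twistInsertion_background_eq_of_card_lt (z : QuantumLattice.Twist d G) (t : Plaquette d L → G)
    (w : Plaquette d L → G → ℝ) {X : Finset (Plaquette d L)} (hX : X.card < L ^ 2) :
    fieldPolymerActivity (twistBy (fun p => t p * twistInsertion z p) w) X = fieldPolymerActivity (twistBy t w) X := by
  rw [← twistBy_twistBy]
  exact fieldPolymerActivity_twistInsertion_eq_of_card_lt z (twistBy t w) hX

/-- **Two twist sectors have the same small-polymer activities**: for twists `z₁, z₂` and `#X < L²`,
`z_{w∘t_{z₁}}(X) = z_{w∘t_{z₂}}(X)`. [cite: Tomboulis2007Confinement, §6.2 (text after eq. (6.9)) and eq. (6.11)]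
[cite: tHooft1979Flux, §2 eqs. (2.5)–(2.6)] -/
theorem fieldPolymerActivity_twistInsertion_eq_twistInsertion_of_card_lt (z₁ z₂ : QuantumLattice.Twist d G)
    (w : Plaquette d L → G → ℝ) {X : Finset (Plaquette d L)} (hX : X.card < L ^ 2) :
    fieldPolymerActivity (twistBy (twistInsertion z₁) w) X = fieldPolymerActivity (twistBy (twistInsertion z₂) w) X := by
  rw [fieldPolymerActivity_twistInsertion_eq_of_card_lt z₁ w hX, fieldPolymerActivity_twistInsertion_eq_of_card_lt z₂ w hX]

end Locality

end CentralTwist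

end Literature.MathematicalPhysics.QuantumFieldTheory

end
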